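import Mathlib
import Summits.NavierStokesRegularity.NavierStokesRegularity.Theorems.FilamentSkeletonRssTangentSkeletonNearStraightLLowBandSymbol

/-!
# The MODIFIED-NEWTON (local-induction) MULTIPLIER WINDOW `m_L(x) = 1 + 2𝔖(x)/(x²L)`
# (`TangentSkeletonNearStraightL`, stmt-NavierStokesRegularity-23320; registered line `child_tangent_analytic_strip_L` b0b56c52900dd90a,
# ∃-side input of the hard stub `stub_analyticClosingL`, PHASE 1 «factor ½ per step» and PHASE 2 «multiplier ellipticity»)

The registered stub statements of the line say (docstring of `LiaSymbolBound`, P3): «Together: the modified-Newton multiplier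
`1 + 2𝔖(kμ)/((kμ)² L̃)` lies in `[0, 1 + (1/6)/L̃]` for `k ≥ 1/L_ball` and is `≤ ½` for `k ≤ k₁`», and PHASE 1 of `AnalyticNewtonClosingL` (P5)
iterates local-induction-preconditioned steps with «factor `½` per step».  The three clauses of `LiaSymbolBound` are theorems of the tree with
standard axioms (`liaSymbolBound_kernel`, p824053), but the multiplier corollary itself — with EXPLICIT thresholds in the logarithmic variable
`ℓ = log(1/x)`, `x = kμ`, against the local-induction logarithm `L = L̃` — was not recorded.  This file records it, def-free, for the exact symbol
`liaSym` of `…Theorems.AnalyticStripLiaSymbolDefs` (the line's `𝔖`, letter for letter):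
* `multiplier_le`            — `m_L(x) ≤ 1 + 1/(6L)` for all `x > 0`, `L > 0` (clause (a));
* `multiplier_nonneg_of_half_le` — `0 ≤ m_L(x)` for `x ≥ ½`, `L ≥ 2/3` (clause (b));
* `multiplier_sharp`         — `|m_L(x) − (L − log(2/x) + γ_E + ½)/L| ≤ 2x²(|log x| + 1)/L` on `(0, ½]` (clause (c), the Klein–Majda asymptotics):
  the multiplier VANISHES to first order exactly at the matched scale `log(2/x⋆) = L + γ_E + ½`, which is the point of the preconditioning;
* `sq_mul_abs_log_add_one_le` — the remainder is small on the low band: `x²(|log x| + 1) ≤ 3/20` for `0 < x ≤ ¼`;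
* `multiplier_le_half`, `neg_half_le_multiplier`, `abs_multiplier_le_half` — on the low band `x ≤ ¼`:
  `L/2 + 7/10 ≤ log(1/x) ⇒ m_L(x) ≤ ½`, `log(1/x) ≤ 3L/2 ⇒ −½ ≤ m_L(x)`; together `|m_L(x)| ≤ ½` on the band
  `L/2 + 7/10 ≤ log(1/x) ≤ 3L/2` of logarithmic half-width `L/2` about the matched scale (PHASE 1's contraction factor);
* `multiplier_nonneg_of_lowBand` (`x ≤ ¼`, `log(1/x) ≤ L`), `neg_sq_le_liaSym_of_midBand` (`−x² ≤ 𝔖(x)` on `[¼, ½]`),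
  `multiplier_nonneg_of_midBand` (`L ≥ 2`), and the assembled WINDOW `multiplier_window`: for `L ≥ 2` and every `x > 0` with `log(1/x) ≤ L`
  (i.e. `k ≥ e^{−L̃}/μ`), `0 ≤ m_L(x) ≤ 1 + 1/(6L)`.
Constants: `0.57721 ≤ γ_E ≤ 0.57726` (`Series.eulerMascheroni_bounds`), `0.6931471803 < log 2 < 0.6931471808` (Mathlib), `log y ≤ y − 1`.
HONEST FRAMING: S-sized real-analysis corollaries (explicit windows for one explicit function) serving the two-phase Newton plan of a HYPOTHETICAL
filament skeleton on the NEGATIVE side of a MODEL route; no registered stub of 23320 is closed by this file (`stub_analyticClosingL` and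
`stub_stripPropagation` stay open), and nothing here bears on Navier–Stokes regularity or blow-up.
`--supports stmt-NavierStokesRegularity-23320`. [folklore; Klein–Majda 1991 / Majda–Bertozzi 2002 §7.1 for the local-induction logarithm]
-/

set_option linter.dupNamespace false

noncomputable section

namespace Summit.NavierStokesRegularity.NavierStokesRegularity.Theorems.AnalyticStripLiaMultiplier

open Real Set
open Summit.NavierStokesRegularity.NavierStokesRegularity.Theorems.AnalyticStripLiaSymbol
open Summit.NavierStokesRegularity.NavierStokesRegularity.Theorems.TangentSkeletonNearStraightLSwirlBand
  (lowBand_constants)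

/-! ## §1 The two one-sided bounds from clauses (a), (b) -/

/-- **Upper bound of the multiplier** (clause (a) `𝔖(x) ≤ x²/12`): `1 + 2𝔖(x)/(x²L) ≤ 1 + 1/(6L)` for all `x > 0`, `L > 0` — in the
anti-local-induction direction the exact self-induction is at most `(1/6)/L` of the local-induction stiffness. [folklore] -/
theorem multiplier_le {L x : ℝ} (hL : 0 < L) (hx : 0 < x) :
    1 + 2 * liaSym x / (x ^ 2 * L) ≤ 1 + 1 / (6 * L) := by
  have h := liaSymbolBound_kernel.1.1 x hx
  have hxL : 0 < x ^ 2 * L := by positivity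
  have hL0 : L ≠ 0 := hL.ne'
  have key : 2 * liaSym x / (x ^ 2 * L) ≤ 1 / (6 * L) := by
    rw [div_le_iff₀ hxL]
    have : 1 / (6 * L) * (x ^ 2 * L) = x ^ 2 / 6 := by
      field_simp
    rw [this]
    linarith
  linarith

/-- **Nonnegativity of the multiplier on the high band** (clause (b) `𝔖(x) ≥ −x²/3` for `x ≥ ½`): `0 ≤ 1 + 2𝔖(x)/(x²L)` as soon as
`L ≥ 2/3`. [folklore] -/
theorem multiplier_nonneg_of_half_le {L x : ℝ} (hL : 2 / 3 ≤ L) (hx : 1 / 2 ≤ x) :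
    0 ≤ 1 + 2 * liaSym x / (x ^ 2 * L) := by
  have h := liaSymbolBound_kernel.1.2.1 x hx
  have hxpos : 0 < x := by linarith
  have hLpos : 0 < L := by linarith
  have hx2 : 0 < x ^ 2 := by positivity
  have hxL : 0 < x ^ 2 * L := by positivity
  have key : -1 ≤ 2 * liaSym x / (x ^ 2 * L) := by
    rw [le_div_iff₀ hxL]
    nlinarith [mul_le_mul_of_nonneg_left hL hx2.le]
  linarith

/-! ## §2 The sharp form on `(0, ½]` from the Klein–Majda asymptotics (clause (c)) -/

/-- **Sharp form of the multiplier on `(0, ½]`.**  With clause (c) `|𝔖(x) − x²((log(x/2)+γ_E)/2 + ¼)| ≤ x⁴(|log x|+1)`: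
`|(1 + 2𝔖(x)/(x²L)) − (L + log(x/2) + γ_E + ½)/L| ≤ 2x²(|log x| + 1)/L`.  The main term `(L − log(2/x) + γ_E + ½)/L` vanishes at the
matched scale `log(2/x⋆) = L + γ_E + ½` — local induction with logarithm `L` is the exact linearisation there to first order. [folklore] -/
theorem multiplier_sharp {L x : ℝ} (hL : 0 < L) (hx : 0 < x) (hx2 : x ≤ 1 / 2) :
    |1 + 2 * liaSym x / (x ^ 2 * L) - (L + Real.log (x / 2) + Real.eulerMascheroniConstant + 1 / 2) / L| ≤
      2 * x ^ 2 * (|Real.log x| + 1) / L := by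
  have hc := liaSymbolBound_kernel.1.2.2 x hx hx2
  have hx2pos : 0 < x ^ 2 := by positivity
  have hL0 : L ≠ 0 := hL.ne'
  have hx0 : x ≠ 0 := hx.ne'
  have hxL : 0 < x ^ 2 * L := by positivity
  have hrew : 1 + 2 * liaSym x / (x ^ 2 * L) - (L + Real.log (x / 2) + Real.eulerMascheroniConstant + 1 / 2) / L =
      2 * (liaSym x - x ^ 2 * ((Real.log (x / 2) + Real.eulerMascheroniConstant) / 2 + 1 / 4)) / (x ^ 2 * L) := by
    field_simp
    ring
  rw [hrew, abs_div, abs_mul, abs_of_pos (by norm_num : (0:ℝ) < 2), abs_of_pos hxL, div_le_div_iff₀ hxL hL]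
  have h4 : x ^ 4 = x ^ 2 * x ^ 2 := by ring
  rw [h4] at hc
  have hnn : 0 ≤ |Real.log x| + 1 := by positivity
  nlinarith [mul_le_mul_of_nonneg_right hc (by positivity : (0:ℝ) ≤ 2 * L), hx2pos, hL]

/-- **The remainder is small on the low band**: `x²(|log x| + 1) ≤ 3/20` for `0 < x ≤ ¼`
(`log(1/x) = log 4 + log(1/(4x)) ≤ log 4 + 1/(4x) − 1`, so `x² log(1/x) ≤ x²(log 4 − 1) + x/4 ≤ (log 4)/16`; `log 4 < 1.3863`). [folklore] -/
theorem sq_mul_abs_log_add_one_le {x : ℝ} (hx : 0 < x) (hx4 : x ≤ 1 / 4) :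
    x ^ 2 * (|Real.log x| + 1) ≤ 3 / 20 := by
  have hx1 : x < 1 := by linarith
  have hlogneg : Real.log x < 0 := Real.log_neg hx hx1
  have habs : |Real.log x| = -Real.log x := abs_of_neg hlogneg
  have hl2a : (0.6931471803 : ℝ) < Real.log 2 := Real.log_two_gt_d9
  have hl2b : Real.log 2 < (0.6931471808 : ℝ) := Real.log_two_lt_d9
  have hl4 : Real.log 4 = 2 * Real.log 2 := by
    rw [show (4:ℝ) = 2 ^ 2 by norm_num, Real.log_pow]; norm_num
  -- `-log x = log 4 + log (1/(4x))` and `log (1/(4x)) ≤ 1/(4x) - 1`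
  have h4x : 0 < 1 / (4 * x) := by positivity
  have hdecomp : -Real.log x = Real.log 4 + Real.log (1 / (4 * x)) := by
    rw [one_div, Real.log_inv, Real.log_mul (by norm_num) hx.ne']; ring
  have hle : Real.log (1 / (4 * x)) ≤ 1 / (4 * x) - 1 := Real.log_le_sub_one_of_pos h4x
  have hx2 : x ^ 2 ≤ 1 / 16 := by nlinarith
  have hx2pos : 0 < x ^ 2 := by positivity
  rw [habs, hdecomp]
  -- x²(log 4 + log(1/(4x)) + 1) ≤ x²(log 4 + 1/(4x)) = x² log 4 + x/4
  have h1 : x ^ 2 * (Real.log 4 + Real.log (1 / (4 * x)) + 1) ≤ x ^ 2 * Real.log 4 + x / 4 := by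
    have : x ^ 2 * (1 / (4 * x)) = x / 4 := by field_simp
    nlinarith [mul_le_mul_of_nonneg_left hle hx2pos.le]
  have h2 : x ^ 2 * Real.log 4 + x / 4 ≤ 3 / 20 := by
    rw [hl4]; nlinarith
  linarith

/-- Logarithmic bookkeeping on `(0, 1)`: `|log x| = log(1/x) = −log x` and `log(x/2) = −log(1/x) − log 2`. [folklore] -/
theorem log_bookkeeping {x : ℝ} (hx : 0 < x) (hx1 : x < 1) :
    |Real.log x| = Real.log (1 / x) ∧ Real.log (1 / x) = -Real.log x ∧
      Real.log (x / 2) = -Real.log (1 / x) - Real.log 2 := by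
  have hlogneg : Real.log x < 0 := Real.log_neg hx hx1
  have h1 : Real.log (1 / x) = -Real.log x := by rw [one_div, Real.log_inv]
  refine ⟨by rw [h1]; exact abs_of_neg hlogneg, h1, ?_⟩
  rw [Real.log_div hx.ne' two_ne_zero, h1]; ring

/-! ## §3 PHASE-1 windows on the low band `x ≤ ¼` (logarithmic variable `ℓ = log(1/x)` against `L`) -/

/-- **Contraction from above**: on the low band, `L/2 + 7/10 ≤ log(1/x)` gives `1 + 2𝔖(x)/(x²L) ≤ ½`
(`γ_E + ½ − log 2 ≤ 0.3842`, remainder `≤ 2·(3/20)`). [folklore] -/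
theorem multiplier_le_half {L x : ℝ} (hL : 0 < L) (hx : 0 < x) (hx4 : x ≤ 1 / 4)
    (hlog : L / 2 + 7 / 10 ≤ Real.log (1 / x)) :
    1 + 2 * liaSym x / (x ^ 2 * L) ≤ 1 / 2 := by
  have hx2 : x ≤ 1 / 2 := by linarith
  have hsharp := (abs_le.mp (multiplier_sharp hL hx hx2)).2
  obtain ⟨habs, -, hx2l⟩ := log_bookkeeping hx (by linarith)
  have hrem := sq_mul_abs_log_add_one_le hx hx4
  obtain ⟨h0, h1, -⟩ := lowBand_constants
  set ℓ := Real.log (1 / x) with hℓ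
  rw [habs] at hrem
  rw [hx2l, habs] at hsharp
  -- main term `(L - ℓ - log 2 + γ + 1/2)/L ≤ (L/2 - 0.3)/L`-ish; remainder `≤ 0.3/L`
  have hL0 : L ≠ 0 := hL.ne'
  have key : (L + (-ℓ - Real.log 2) + Real.eulerMascheroniConstant + 1 / 2) / L + 2 * x ^ 2 * (ℓ + 1) / L ≤ 1 / 2 := by
    rw [← add_div, div_le_iff₀ hL]
    nlinarith
  linarith

/-- **Contraction from below**: on the low band, `log(1/x) ≤ 3L/2` gives `−½ ≤ 1 + 2𝔖(x)/(x²L)`. [folklore] -/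
theorem neg_half_le_multiplier {L x : ℝ} (hL : 0 < L) (hx : 0 < x) (hx4 : x ≤ 1 / 4)
    (hlog : Real.log (1 / x) ≤ 3 * L / 2) :
    -(1 / 2) ≤ 1 + 2 * liaSym x / (x ^ 2 * L) := by
  have hx2 : x ≤ 1 / 2 := by linarith
  have hsharp := (abs_le.mp (multiplier_sharp hL hx hx2)).1
  obtain ⟨habs, -, hx2l⟩ := log_bookkeeping hx (by linarith)
  have hrem := sq_mul_abs_log_add_one_le hx hx4
  obtain ⟨hγ1, -⟩ := Series.eulerMascheroni_bounds
  have hl2b : Real.log 2 < (0.6931471808 : ℝ) := Real.log_two_lt_d9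
  set ℓ := Real.log (1 / x) with hℓ
  rw [habs] at hrem
  rw [hx2l, habs] at hsharp
  have hL0 : L ≠ 0 := hL.ne'
  have key : -(1 / 2) ≤ (L + (-ℓ - Real.log 2) + Real.eulerMascheroniConstant + 1 / 2) / L - 2 * x ^ 2 * (ℓ + 1) / L := by
    rw [← sub_div, le_div_iff₀ hL]
    nlinarith
  linarith

/-- **PHASE-1 contraction factor `½`**: on the band `L/2 + 7/10 ≤ log(1/x) ≤ 3L/2` (logarithmic half-width `L/2` about the matched scale)
inside the low band `x ≤ ¼`, `|1 + 2𝔖(x)/(x²L)| ≤ ½`. [folklore] -/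
theorem abs_multiplier_le_half {L x : ℝ} (hL : 0 < L) (hx : 0 < x) (hx4 : x ≤ 1 / 4)
    (hlo : L / 2 + 7 / 10 ≤ Real.log (1 / x)) (hhi : Real.log (1 / x) ≤ 3 * L / 2) :
    |1 + 2 * liaSym x / (x ^ 2 * L)| ≤ 1 / 2 :=
  abs_le.mpr ⟨neg_half_le_multiplier hL hx hx4 hhi, multiplier_le_half hL hx hx4 hlo⟩

/-- **Nonnegativity on the low band below the matched scale**: `x ≤ ¼` and `log(1/x) ≤ L` give `0 ≤ 1 + 2𝔖(x)/(x²L)`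
(`γ_E − log 2 + 1/5 ≥ 0` absorbs the remainder). [folklore] -/
theorem multiplier_nonneg_of_lowBand {L x : ℝ} (hL : 0 < L) (hx : 0 < x) (hx4 : x ≤ 1 / 4)
    (hlog : Real.log (1 / x) ≤ L) :
    0 ≤ 1 + 2 * liaSym x / (x ^ 2 * L) := by
  have hx2 : x ≤ 1 / 2 := by linarith
  have hsharp := (abs_le.mp (multiplier_sharp hL hx hx2)).1
  obtain ⟨habs, -, hx2l⟩ := log_bookkeeping hx (by linarith)
  have hrem := sq_mul_abs_log_add_one_le hx hx4
  obtain ⟨hγ1, -⟩ := Series.eulerMascheroni_bounds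
  have hl2b : Real.log 2 < (0.6931471808 : ℝ) := Real.log_two_lt_d9
  set ℓ := Real.log (1 / x) with hℓ
  rw [habs] at hrem
  rw [hx2l, habs] at hsharp
  have hL0 : L ≠ 0 := hL.ne'
  have key : 0 ≤ (L + (-ℓ - Real.log 2) + Real.eulerMascheroniConstant + 1 / 2) / L - 2 * x ^ 2 * (ℓ + 1) / L := by
    rw [← sub_div]
    apply div_nonneg _ hL.le
    nlinarith
  linarith

/-! ## §4 The gap `[¼, ½]` and the assembled window -/

/-- **Mid-band lower bound**: `−x² ≤ 𝔖(x)` for `¼ ≤ x ≤ ½` (clause (c) with `x²(|log x|+1) ≤ x` from `log(1/x) ≤ 1/x − 1`, split at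
`x = 7/20`: `log x ≥ −log 4` on the left piece, `log x ≥ −log 2 − 3/7` on the right piece). [folklore] -/
theorem neg_sq_le_liaSym_of_midBand {x : ℝ} (hx4 : 1 / 4 ≤ x) (hx2 : x ≤ 1 / 2) : -(x ^ 2) ≤ liaSym x := by
  have hx : 0 < x := by linarith
  have hc := (abs_le.mp (liaSymbolBound_kernel.1.2.2 x hx hx2)).1
  obtain ⟨habs, hinv, hx2l⟩ := log_bookkeeping hx (by linarith)
  obtain ⟨hγ1, -⟩ := Series.eulerMascheroni_bounds
  have hl2b : Real.log 2 < (0.6931471808 : ℝ) := Real.log_two_lt_d9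
  have hx2pos : 0 < x ^ 2 := by positivity
  -- remainder: x²(|log x| + 1) ≤ x
  have hrem : x ^ 2 * (|Real.log x| + 1) ≤ x := by
    rw [habs]
    have hle : Real.log (1 / x) ≤ 1 / x - 1 := Real.log_le_sub_one_of_pos (by positivity)
    have : x ^ 2 * (1 / x - 1 + 1) = x := by field_simp; ring
    nlinarith [mul_le_mul_of_nonneg_left hle hx2pos.le]
  have h4 : x ^ 4 * (|Real.log x| + 1) = x ^ 2 * (x ^ 2 * (|Real.log x| + 1)) := by ring
  rw [h4] at hc
  -- lower bound for `log x`
  rcases le_or_gt x (7 / 20) with hcase | hcase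
  · -- `1/4 ≤ x ≤ 7/20`: `log x ≥ -log 4 = -2 log 2`
    have hlogx : -(2 * Real.log 2) ≤ Real.log x := by
      have h := Real.log_le_log (by norm_num : (0:ℝ) < 1 / 4) hx4
      have : Real.log (1 / 4 : ℝ) = -(2 * Real.log 2) := by
        rw [one_div, Real.log_inv, show (4:ℝ) = 2 ^ 2 by norm_num, Real.log_pow]; norm_num
      linarith
    rw [Real.log_div hx.ne' two_ne_zero] at hc
    nlinarith [mul_le_mul_of_nonneg_left hrem hx2pos.le]
  · -- `7/20 < x ≤ 1/2`: `log x ≥ log (7/20) ≥ -log 2 - 3/7` (`log (10/7) ≤ 3/7`)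
    have hlogx : -Real.log 2 - 3 / 7 ≤ Real.log x := by
      have h := Real.log_le_log (by norm_num : (0:ℝ) < 7 / 20) hcase.le
      have h107 : Real.log (10 / 7 : ℝ) ≤ 10 / 7 - 1 := Real.log_le_sub_one_of_pos (by norm_num)
      have : Real.log (7 / 20 : ℝ) = -(Real.log 2 + Real.log (10 / 7)) := by
        rw [← Real.log_mul (by norm_num) (by norm_num), ← Real.log_inv]; norm_num
      linarith
    rw [Real.log_div hx.ne' two_ne_zero] at hc
    nlinarith [mul_le_mul_of_nonneg_left hrem hx2pos.le]

/-- **Nonnegativity on the mid band**: `¼ ≤ x ≤ ½` and `L ≥ 2` give `0 ≤ 1 + 2𝔖(x)/(x²L)`. [folklore] -/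
theorem multiplier_nonneg_of_midBand {L x : ℝ} (hL : 2 ≤ L) (hx4 : 1 / 4 ≤ x) (hx2 : x ≤ 1 / 2) :
    0 ≤ 1 + 2 * liaSym x / (x ^ 2 * L) := by
  have h := neg_sq_le_liaSym_of_midBand hx4 hx2
  have hx : 0 < x := by linarith
  have hLpos : 0 < L := by linarith
  have hx2p : 0 < x ^ 2 := by positivity
  have hxL : 0 < x ^ 2 * L := by positivity
  have key : -1 ≤ 2 * liaSym x / (x ^ 2 * L) := by
    rw [le_div_iff₀ hxL]
    nlinarith [mul_le_mul_of_nonneg_left hL hx2p.le]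
  linarith

/-- **THE MULTIPLIER WINDOW** (the «`[0, 1 + (1/6)/L̃]` for `k ≥ 1/L_ball`» clause of the registered P3 docstring, with the threshold made
explicit): for `L ≥ 2` and every `x > 0` with `log(1/x) ≤ L` (no condition when `x ≥ ¼`), `0 ≤ 1 + 2𝔖(x)/(x²L) ≤ 1 + 1/(6L)`. [folklore] -/
theorem multiplier_window {L x : ℝ} (hL : 2 ≤ L) (hx : 0 < x) (hlog : Real.log (1 / x) ≤ L) :
    0 ≤ 1 + 2 * liaSym x / (x ^ 2 * L) ∧ 1 + 2 * liaSym x / (x ^ 2 * L) ≤ 1 + 1 / (6 * L) := by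
  have hLpos : 0 < L := by linarith
  refine ⟨?_, multiplier_le hLpos hx⟩
  rcases le_or_gt x (1 / 4) with h4 | h4
  · exact multiplier_nonneg_of_lowBand hLpos hx h4 hlog
  rcases le_or_gt x (1 / 2) with h2 | h2
  · exact multiplier_nonneg_of_midBand hL h4.le h2
  · exact multiplier_nonneg_of_half_le (by linarith) h2.le

end Summit.NavierStokesRegularity.NavierStokesRegularity.Theorems.AnalyticStripLiaMultiplier

end
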